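import Summits.AnomalousDissipation.AnomalousDissipation.Theorems.SawtoothPulseCascadeK1LocalisedCascadeCornerTraceSum
import Summits.AnomalousDissipation.AnomalousDissipation.Theorems.SawtoothPulseCascadeK1LocalisedCascadeHalfStepV

/-!
# K1loc, line `Spectral` / thin start — helper: THE CORNER-TRACE BOUND FOR THE NEGATIVE LOBE (S-D constants, «CT» wrapper)

Helper file of the prover lane on the crux `K1LocalisedCascade` (stmt-AnomalousDissipation-19491), route
`SawtoothPulseCascade` (S-D fibre ledger; arbiter A23-11 (iv)(b): the `λ = −L₂` reflection wanted by the CT dischargers).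
`…CornerTraceSum.cornerTrace_sum_sq_le` is stated for the exact `N`-tooth chirp with POSITIVE lobe `λ = L₂` (fibres `n > 0`,
`λ = nγ`).  For `λ = −L₂` the coefficients reflect, `ĝ₀^{(−L₂)}(m) = ĝ₀^{(L₂)}(−m)` (`…CornerTraceTerm.fourierCoeff_nTooth_exactChirp`),
so reindexing `k ↦ −k`, `l ↦ −l` gives **`cornerTrace_sum_sq_le_neg`**: the same bound with the corner values of
`T(y) = Σ_l c_l e^{2πily}` taken at the REFLECTED corners `−(4r∓1)/(4N)` (any finite set of evaluation points serves the
half-step, which bounds `Σ_n |T_n(y)|²` uniformly in `y`).  No definitions; nothing about the crux.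
[cite: Grafakos2014, Prop. 3.1.2 (5), §3.1.3] [problem: turb]
-/

-- `Summit.<Summit>.<Problem>`: single-conjunct summit, the duplicate namespace segment is deliberate.
set_option linter.dupNamespace false

noncomputable section

namespace Summit.AnomalousDissipation.AnomalousDissipation.Theorems.SawtoothPulseCascade.K1Window

open MeasureTheory Set Filter Topology Function Complex AddCircle
open scoped Real
open Literature.Analysis Literature.Analysis.FunctionSpaces Literature.Analysis.FunctionSpaces.Torus Literature.Analysis.FluidPDE
open Literature.Analysis.FluidPDE.SawtoothCascade
open Summit.AnomalousDissipation.AnomalousDissipation.Theorems.SawtoothPulseCascade.K1Start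

/-- **Reflection of the `N`-tooth coefficients**: `ĝ₀^{(−λ)}(m) = ĝ₀^{(λ)}(−m)` whenever `λ ± m ≠ 0`. [folklore] -/
theorem fourierCoeff_nTooth_exactChirp_neg {N : ℕ} (hN : 0 < N) (lam : ℤ) {g g' : UnitAddCircle → ℂ}
    (hg : ∀ t : ℝ, g (t : UnitAddCircle) = Complex.exp (-(2 * π * I * ((-lam : ℤ) : ℂ) * ((tri (2 * π * N * t) / (2 * π * N) : ℝ) : ℂ))))
    (hg' : ∀ t : ℝ, g' (t : UnitAddCircle) = Complex.exp (-(2 * π * I * lam * ((tri (2 * π * N * t) / (2 * π * N) : ℝ) : ℂ))))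
    {m : ℤ} (hm₁ : lam + m ≠ 0) (hm₂ : lam - m ≠ 0) :
    fourierCoeff g m = fourierCoeff g' (-m) := by
  rw [fourierCoeff_nTooth_exactChirp hN (-lam) hg (m := m) (by omega) (by omega),
    fourierCoeff_nTooth_exactChirp hN lam hg' (m := -m) (by omega) (by omega)]
  have hdvd : ((N : ℤ) ∣ m) ↔ ((N : ℤ) ∣ -m) := (dvd_neg).symm
  by_cases h : (N : ℤ) ∣ m
  · rw [if_pos h, if_pos (hdvd.mp h)]
    congr 1
    push_cast
    have e1 : Real.sin (π * (-(lam : ℝ) + m) / (2 * N)) = -Real.sin (π * (lam + -(m : ℝ)) / (2 * N)) := by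
      rw [← Real.sin_neg]; congr 1; ring
    rw [e1]
    have e2 : (N : ℝ) / (π * (-(lam : ℝ) + m)) = -((N : ℝ) / (π * (lam + -(m : ℝ)))) := by
      rw [← div_neg]; congr 1; ring
    have e3 : (N : ℝ) / (π * (-(lam : ℝ) - m)) = -((N : ℝ) / (π * (lam - -(m : ℝ)))) := by
      rw [← div_neg]; congr 1; ring
    rw [e2, e3]; ring
  · rw [if_neg h, if_neg (fun h' => h (hdvd.mpr h'))]

set_option maxHeartbeats 400000 in
/-- **THE CORNER-TRACE BOUND, NEGATIVE LOBE** (`λ = −L₂`; see `…CornerTraceSum.cornerTrace_sum_sq_le` for the data): the same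
right-hand side with the corner values of `T` taken at the reflected corners `−(4r−1)/(4N)` and `−(4r+1)/(4N)`.
[cite: Grafakos2014, Prop. 3.1.2 (5), §3.1.3] -/
theorem cornerTrace_sum_sq_le_neg {N : ℕ} (hN : 0 < N) {L₂ : ℕ} {g₀ : UnitAddCircle → ℂ}
    (hg₀ : ∀ t : ℝ, g₀ (t : UnitAddCircle) =
      Complex.exp (-(2 * π * I * ((-(L₂ : ℤ) : ℤ) : ℂ) * ((tri (2 * π * N * t) / (2 * π * N) : ℝ) : ℂ))))
    (c : ℤ → ℂ) (S : Finset ℤ) {L D : ℕ} (hD : 0 < D) (hS : ∀ l ∈ S, |l| ≤ L) {M : ℝ}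
    (hM : ∀ k : ℤ, (((S.filter fun l => (N : ℤ) ∣ k - l).card : ℕ) : ℝ) ≤ M)
    (W : Finset ℤ) (hW : ∀ k ∈ W, |k| + L + D ≤ (L₂ : ℤ)) :
    ∑ k ∈ W, ‖∑ l ∈ S, c l * fourierCoeff g₀ (k - l)‖ ^ 2 ≤
      3 * N * (1 / ((D : ℝ) + L) ^ 2 + 1 / (N * ((D : ℝ) + L))) / π ^ 2 *
          (∑ r ∈ Finset.range N, ‖∑ l ∈ S, c l * Complex.exp (2 * π * I * l * (-((4 * (r : ℝ) - 1) / (4 * N))))‖ ^ 2 +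
            ∑ r ∈ Finset.range N, ‖∑ l ∈ S, c l * Complex.exp (2 * π * I * l * (-((4 * (r : ℝ) + 1) / (4 * N))))‖ ^ 2) +
        12 * N ^ 2 * L ^ 2 * M * (1 / ((D : ℝ) + L) ^ 2 + 1 / (N * ((D : ℝ) + L))) / (π ^ 2 * D ^ 2) *
          ∑ l ∈ S, ‖c l‖ ^ 2 := by
  classical
  -- the positive-lobe chirp
  obtain ⟨hg'c, hg'⟩ := continuous_exactChirp_lift N (L₂ : ℤ)
  set g' := (periodic_exactChirpFun N (L₂ : ℤ)).lift with hg'def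
  -- reflect the coefficients
  have hcoef : ∀ k ∈ W, ∀ l ∈ S, fourierCoeff g₀ (k - l) = fourierCoeff g' ((-k) - (-l)) := by
    intro k hk l hl
    have h1 := hW k hk; have h2 := hS l hl
    have hk' := le_abs_self k; have hk'' := neg_abs_le k; have hl' := le_abs_self l; have hl'' := neg_abs_le l
    rw [show (-k) - (-l) = -(k - l) by ring]
    exact fourierCoeff_nTooth_exactChirp_neg hN (L₂ : ℤ) hg₀ hg' (by omega) (by omega)
  -- reindex `l ↦ −l`, `k ↦ −k`
  set c' : ℤ → ℂ := fun l => c (-l) with hc'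
  set S' : Finset ℤ := S.image (fun l => -l) with hS'
  set W' : Finset ℤ := W.image (fun k => -k) with hW'
  have hinjS : Set.InjOn (fun l : ℤ => -l) S := fun a _ b _ h => neg_injective h
  have hinjW : Set.InjOn (fun k : ℤ => -k) W := fun a _ b _ h => neg_injective h
  have hinner : ∀ k ∈ W, ∑ l ∈ S, c l * fourierCoeff g₀ (k - l) = ∑ l' ∈ S', c' l' * fourierCoeff g' ((-k) - l') := by
    intro k hk
    rw [hS', Finset.sum_image hinjS]
    refine Finset.sum_congr rfl fun l hl => ?_
    simp only [hc', neg_neg]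
    rw [hcoef k hk l hl]
  have hLHS : ∑ k ∈ W, ‖∑ l ∈ S, c l * fourierCoeff g₀ (k - l)‖ ^ 2 =
      ∑ k' ∈ W', ‖∑ l' ∈ S', c' l' * fourierCoeff g' (k' - l')‖ ^ 2 := by
    rw [hW', Finset.sum_image hinjW]
    exact Finset.sum_congr rfl fun k hk => by rw [hinner k hk]
  rw [hLHS]
  -- hypotheses for the reflected data
  have hS'' : ∀ l ∈ S', |l| ≤ L := by
    intro l hl
    obtain ⟨l₀, hl₀, rfl⟩ := Finset.mem_image.mp hl
    rw [abs_neg]; exact hS l₀ hl₀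
  have hW'' : ∀ k ∈ W', |k| + L + D ≤ (L₂ : ℤ) := by
    intro k hk
    obtain ⟨k₀, hk₀, rfl⟩ := Finset.mem_image.mp hk
    rw [abs_neg]; exact hW k₀ hk₀
  have hM'' : ∀ k : ℤ, (((S'.filter fun l => (N : ℤ) ∣ k - l).card : ℕ) : ℝ) ≤ M := by
    intro k
    have hset : S'.filter (fun l => (N : ℤ) ∣ k - l) = (S.filter fun l => (N : ℤ) ∣ (-k) - l).image (fun l => -l) := by
      ext l
      simp only [hS', Finset.mem_filter, Finset.mem_image]
      constructor
      · rintro ⟨⟨l₀, hl₀, rfl⟩, hd⟩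
        exact ⟨l₀, ⟨hl₀, by rw [show -k - l₀ = -(k - -l₀) by ring]; exact (dvd_neg).mpr hd⟩, rfl⟩
      · rintro ⟨l₀, ⟨hl₀, hd⟩, rfl⟩
        exact ⟨⟨l₀, hl₀, rfl⟩, by rw [show k - -l₀ = -(-k - l₀) by ring]; exact (dvd_neg).mpr hd⟩
    rw [hset, Finset.card_image_of_injective _ neg_injective]
    exact hM (-k)
  have hmain := cornerTrace_sum_sq_le hN hg' c' S' hD hS'' hM'' W' hW''
  -- identify the right-hand sides
  have hT : ∀ y : ℝ, ∑ l ∈ S', c' l * Complex.exp (2 * π * I * l * y) =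
      ∑ l ∈ S, c l * Complex.exp (2 * π * I * l * ((-y : ℝ) : ℂ)) := by
    intro y
    rw [hS', Finset.sum_image hinjS]
    refine Finset.sum_congr rfl fun l _ => ?_
    simp only [hc', neg_neg]
    congr 2; push_cast; ring
  have hc2 : ∑ l ∈ S', ‖c' l‖ ^ 2 = ∑ l ∈ S, ‖c l‖ ^ 2 := by
    rw [hS', Finset.sum_image hinjS]
    simp only [hc', neg_neg]
  have hT1 : ∀ r : ℕ, ∑ l ∈ S', c' l * Complex.exp (2 * π * I * l * ((4 * (r : ℝ) - 1) / (4 * N))) =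
      ∑ l ∈ S, c l * Complex.exp (2 * π * I * l * (-((4 * (r : ℝ) - 1) / (4 * N)))) := by
    intro r
    have h := hT ((4 * (r : ℝ) - 1) / (4 * N))
    push_cast at h ⊢
    exact h
  have hT2 : ∀ r : ℕ, ∑ l ∈ S', c' l * Complex.exp (2 * π * I * l * ((4 * (r : ℝ) + 1) / (4 * N))) =
      ∑ l ∈ S, c l * Complex.exp (2 * π * I * l * (-((4 * (r : ℝ) + 1) / (4 * N)))) := by
    intro r
    have h := hT ((4 * (r : ℝ) + 1) / (4 * N))
    push_cast at h ⊢
    exact h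
  simp_rw [hT1, hT2, hc2] at hmain
  exact hmain

end Summit.AnomalousDissipation.AnomalousDissipation.Theorems.SawtoothPulseCascade.K1Window
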